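import Mathlib

/-!
# Phase-torus law in the μ₆ frame — typed spec + covering lemma (plan-lens-HodgeAV-embed g0, BLOCK E4, 2026-08-29)

Crux of record: `…Theses.EightfoldBlochSeeds.BlochSeedDiscOne` (item stmt-HodgeConjecture-18881); the μ₆ frame is the one of
crux #4 `BlochSeedDiscThree` (`HasHyperbolicBlochSeed 4 3`, K′ = ℚ(√−3) = ℚ(ω)).  **Nothing in this file proves HC, HC_AV, HC_CM, H2,
18881 or #4**: it is finite harmonic analysis on the phase torus `(μ₆)⁴ = (ℤ/6)⁴`, the μ₆ companion of `PhaseTorusLaw.lean` v4 7c21a751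
(`PT`, `chi`, `KAdm`, `moment`, `PhaseTorusLaw`, `CoveringLemma`) under the transplant dictionary of the memo
`Cruxes/BlochSeedDiscOne/MU6-DICTIONARY-embed-g0.md` §1/§3 (E = ℂ/ℤ[ω], anchor `(E_ω × E_ω̄)⁴`, null rays `(c, c·ζ̄₆^k)`, `k : Fin 6`).

DICTIONARY (v4 ↦ here): `PT = Fin 4 → ZMod 4` ↦ `PT6 = Fin 4 → ZMod 6`; `chi k τ = I ^ (Σ k_f τ_f).val` ↦ `chi6 k τ = ζ₆ ^ (Σ k_f τ_f).val`
with `ζ₆ = ⟨1/2, √3/2⟩`; `KAdm` (entries `≠ 2`, `k ≠ 1⃗, 3⃗`) ↦ `KAdm6` (entries in `{0, 1, 5} = {0, ±1}`, `k ≠ 1⃗, 5⃗`) — 79 characters in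
both frames; `NonOpp y ≠ x + 2` ↦ `Adj6` (`y − x ∈ {0, ±1}`); the pigeonhole «among three values of ℤ/4 two are non-opposite» ↦ «among FOUR
values of ℤ/6 two are adjacent-or-equal» (`adj6_of_four`; a pairwise-far subset of ℤ/6 has ≤ 3 elements, e.g. `{0,2,4}` — so three values do
NOT suffice, four do); everything else in v4's five-step proof is field-free.

CONTENTS (sorry-free, axioms standard): §1 torus, characters, admissible set, moments, the law `PhaseTorusLaw6N γ` at corank `≤ γ` and its
corank-free form; §2 the μ₆ covering lemma `coveringLemma6_holds` (|A| ≤ 4: a free coordinate and a hosting of the points on the other three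
coordinates with adjacent-or-equal values on shared coordinates) and its box form `coveringLemmaBox6_holds` (hosting pairs `{s_f, s_f + 1}`);
§3 the DOWN orientation (field-free bookkeeping); §4 `ζ₆` algebra (`ζ² = ζ − 1`, `ζ³ = −1`, `ζ⁶ = 1`, `|ζ| = 1`), characters, conjugation,
the pairing expansion (`Finset.prod_univ_sum`); §5 bumps: the three-term Re-form `bump6 a t = 1 + 2Re(a ζ^t)` with coefficient table `coef3`
(modes `2,3,4` FREE of coefficients), the μ₆ hosting coefficient `κ₆ = (−1/2, √3/6)` whose bump IS the value table `bumpPair6 = (0,0,1,2,2,1)`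
on `(s, s+1, …, s+5)` (six cases), the free bump `1 + ½Re ζ^{t−w} > 0`; §6 assembly: `rot_step6` (one rotation: `Re(c(w)·μ) ≤ 0`) and
**`phaseTorusLaw6_holds : PhaseTorusLaw6N 4`** — THE μ₆ LAW AT THE SEED RANK IS A KERNEL THEOREM (four of the six rotations, `w = 0, 3, 5, 2`,
already pin `P·μ/4 = 0`; `√3 ≠ 0` is the only irrationality used).  So «the torus law is a μ₄ phenomenon» is REFUTED in the kernel: two-term
rank-≤4 presentations with `μ ≠ 0` are dead on `(E_ω × E_ω̄)⁴` exactly as on `(E_i × E_{−i})⁴` (the design-level dictionary (M)(T) of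
`LinePhaseTorus.lean` is field-free, memo §1).  Numerically (memo §4) the BOX form holds for every `|A| ≤ 5` and fails first at a 6-set
(`γ_box(μ₆) = 5` vs `γ_box(μ₄) = 7`), and the law itself fails at corank 15 (explicit rational measure) — as in μ₄ (window `9 ≤ γ* ≤ 14`),
there is no corank-uniform law.
-/

namespace Summit.HodgeConjecture.HodgeConjecture.Cruxes.BlochSeedDiscOne.PhaseTorusMu6

open Finset BigOperators

/-! ## §1 The torus `(μ₆)⁴`, characters, clean frequencies, moments, the law -/

/-- The phase torus `(μ₆)⁴`, written additively: `t_f = ζ₆^{τ_f}`. -/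
abbrev PT6 : Type := Fin 4 → ZMod 6

/-- `ζ₆ = e^{2πi/6} = 1/2 + (√3/2)i`, given by coordinates (no transcendental functions). -/
noncomputable def zeta6 : ℂ := ⟨1 / 2, Real.sqrt 3 / 2⟩

/-- `u6 s = ζ₆^s` on `ℤ/6`. -/
noncomputable def u6 (s : ZMod 6) : ℂ := zeta6 ^ s.val

/-- The character `χ_k(τ) = ζ₆^{Σ_f k_f τ_f}`. -/
noncomputable def chi6 (k τ : PT6) : ℂ := u6 (∑ f, k f * τ f)

/-- Admissible («clean») frequencies: every entry in `{0, ±1} = {0, 1, 5}` and `k ≠ ±(1,1,1,1)` — the (H1) rows seen by the top word after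
the transport identity (T); the same 79 characters as in the μ₄ frame (the dictionary does not change the admissible exponents, only the torus). -/
def KAdm6 (k : PT6) : Prop := (∀ f, k f = 0 ∨ k f = 1 ∨ k f = 5) ∧ k ≠ (fun _ => 1) ∧ k ≠ (fun _ => 5)

/-- The `k`-th moment of a real signed measure `ω` on `(μ₆)⁴`. -/
noncomputable def moment6 (ω : PT6 → ℝ) (k : PT6) : ℂ := ∑ τ, (ω τ : ℂ) * chi6 k τ

/-- **μ₆ phase-torus law at corank `≤ γ`**: a real signed measure on `(μ₆)⁴` whose clean moments vanish and which is non-positive outside at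
most `γ` points has vanishing top moment `moment6 ω (1,1,1,1) = μ`.  (v4's `PhaseTorusLaw` is the μ₄ frame at `γ = 4`.) -/
def PhaseTorusLaw6N (γ : ℕ) : Prop :=
  ∀ (ω : PT6 → ℝ) (A : Finset PT6), A.card ≤ γ → (∀ τ, τ ∉ A → ω τ ≤ 0) →
    (∀ k, KAdm6 k → moment6 ω k = 0) → moment6 ω (fun _ => 1) = 0

/-- the corank-free form (FALSE, like its μ₄ sibling: explicit violating measure at corank 15, memo §4). -/
def PhaseTorusLaw6All : Prop :=
  ∀ (ω : PT6 → ℝ) (A : Finset PT6), (∀ τ, τ ∉ A → ω τ ≤ 0) →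
    (∀ k, KAdm6 k → moment6 ω k = 0) → moment6 ω (fun _ => 1) = 0

/-- monotone in the corank bound. -/
theorem phaseTorusLaw6N_mono {γ γ' : ℕ} (h : γ' ≤ γ) (H : PhaseTorusLaw6N γ) : PhaseTorusLaw6N γ' :=
  fun ω A hA hω hK => H ω A (hA.trans h) hω hK

/-- the corank-free law is the conjunction of all finite-corank laws. -/
theorem phaseTorusLaw6All_iff : PhaseTorusLaw6All ↔ ∀ γ, PhaseTorusLaw6N γ :=
  ⟨fun H _ ω A _ hω hK => H ω A hω hK, fun H ω A hω hK => H A.card ω A le_rfl hω hK⟩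

/-- **the seed-rank law** (corank `≤ 4` in the μ₆ frame); PROVED below as `phaseTorusLaw6_holds`. -/
def PhaseTorusLaw6 : Prop := PhaseTorusLaw6N 4

theorem phaseTorusLaw6_iff : PhaseTorusLaw6 ↔ PhaseTorusLaw6N 4 := Iff.rfl

/-! ## §2 The μ₆ covering lemma -/

/-- Two phases `ζ^x, ζ^y` are ADJACENT-OR-EQUAL (`y − x ∈ {0, ±1}`): `{x, y}` lies in a pair `{s, s+1}` = the zero set of the non-negative
degree-one trigonometric polynomial `1 − (2/√3)·Re(e^{−iπ/6} s̄ t)` on `μ₆` (value table `(0,0,1,2,2,1)`). -/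
def Adj6 (x y : ZMod 6) : Prop := y = x ∨ y = x + 1 ∨ x = y + 1

theorem adj6_refl (x : ZMod 6) : Adj6 x x := Or.inl rfl

theorem adj6_symm {x y : ZMod 6} (h : Adj6 x y) : Adj6 y x := by
  rcases h with h | h | h
  · exact Or.inl h.symm
  · exact Or.inr (Or.inr h)
  · exact Or.inr (Or.inl h)

/-- **pigeonhole in `ℤ/6`**: among any FOUR values two are adjacent-or-equal (a pairwise-far subset of `ℤ/6` has at most three elements). -/
theorem adj6_of_four (x y z w : ZMod 6) :
    Adj6 x y ∨ Adj6 x z ∨ Adj6 x w ∨ Adj6 y z ∨ Adj6 y w ∨ Adj6 z w := by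
  unfold Adj6; revert x y z w; decide

/-- three values do NOT suffice in `ℤ/6` (they do in `ℤ/4`, v4 `nonOpp_of_three`): `{0, 2, 4}` is pairwise far. -/
theorem not_adj6_of_three : ¬ (Adj6 0 2 ∨ Adj6 0 4 ∨ Adj6 2 4) := by
  unfold Adj6; decide

/-- **μ₆ covering lemma** (shape of v4 `CoveringLemma`): at most four points of `(μ₆)⁴` can be assigned to three of the four coordinates so
that points sharing a coordinate carry adjacent-or-equal values there; the fourth coordinate stays FREE. -/
def CoveringLemma6 : Prop :=
  ∀ A : Finset PT6, A.card ≤ 4 →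
    ∃ f₀ : Fin 4, ∃ g : PT6 → Fin 4, (∀ a ∈ A, g a ≠ f₀) ∧
      ∀ a ∈ A, ∀ b ∈ A, g a = g b → Adj6 (a (g a)) (b (g a))

/-- If `g` is injective on `A`, the same-coordinate condition holds trivially. -/
theorem cover6_of_injOn {A : Finset PT6} {g : PT6 → Fin 4} (hg : Set.InjOn g A) :
    ∀ a ∈ A, ∀ b ∈ A, g a = g b → Adj6 (a (g a)) (b (g a)) := by
  intro a ha b hb h
  obtain rfl := hg ha hb h
  exact adj6_refl _

/-- hosting recipe for four distinct points: `p, q` share coordinate `0` (values adjacent there), `r ↦ 1`, `t ↦ 2`, coordinate `3` free. -/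
theorem cover6_four {A : Finset PT6} {p q r t : PT6} (hmem : ∀ x, x ∈ A ↔ x = p ∨ x = q ∨ x = r ∨ x = t)
    (hpr : p ≠ r) (hpt : p ≠ t) (hqr : q ≠ r) (hqt : q ≠ t) (hrt : r ≠ t) (h : Adj6 (p 0) (q 0)) :
    ∃ f₀ : Fin 4, ∃ g : PT6 → Fin 4, (∀ a ∈ A, g a ≠ f₀) ∧
      ∀ a ∈ A, ∀ b ∈ A, g a = g b → Adj6 (a (g a)) (b (g a)) := by
  have htr := hrt.symm
  refine ⟨3, fun x => if x = r then 1 else if x = t then 2 else 0,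
    fun x _ => by dsimp only; split_ifs <;> decide, fun a ha b hb => ?_⟩
  rw [hmem] at ha hb
  rcases ha with rfl | rfl | rfl | rfl <;> rcases hb with rfl | rfl | rfl | rfl <;>
    simp [hpr, hpt, hqr, hqt, htr, adj6_refl, h, adj6_symm h]

/-- **The μ₆ covering lemma holds**: `|A| ≤ 3` — distinct coordinates; `|A| = 4` — by `adj6_of_four` two of the four values at coordinate `0`
are adjacent-or-equal; host that pair on `0`, the other two points on `1`, `2`; coordinate `3` free. -/
theorem coveringLemma6_holds : CoveringLemma6 := by
  intro A hA
  have hnd : A.toList.Nodup := A.nodup_toList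
  have hlen : A.toList.length ≤ 4 := by rw [Finset.length_toList]; exact hA
  have hmem : ∀ p, p ∈ A ↔ p ∈ A.toList := fun p => Finset.mem_toList.symm
  generalize A.toList = l at hnd hlen hmem
  rcases l with _ | ⟨a, _ | ⟨b, _ | ⟨c, _ | ⟨d, _ | ⟨e, l⟩⟩⟩⟩⟩
  · refine ⟨0, fun _ => 1, fun p hp => ?_, fun p hp => ?_⟩ <;> simp [hmem] at hp
  · refine ⟨3, fun _ => 0, fun _ _ => show (0 : Fin 4) ≠ 3 by decide, fun p hp q hq _ => ?_⟩
    simp only [hmem, List.mem_cons, List.not_mem_nil, or_false] at hp hq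
    subst hp; subst hq; exact adj6_refl _
  · simp only [List.nodup_cons, List.mem_cons, List.not_mem_nil, or_false] at hnd
    obtain ⟨hab, -⟩ := hnd
    refine ⟨3, fun p => if p = a then 0 else 1, fun p _ => by dsimp only; split_ifs <;> decide, ?_⟩
    refine cover6_of_injOn fun p hp q hq h => ?_
    simp only [Finset.mem_coe, hmem, List.mem_cons, List.not_mem_nil, or_false] at hp hq
    rcases hp with rfl | rfl <;> rcases hq with rfl | rfl <;> simp_all [eq_comm]
  · simp only [List.nodup_cons, List.mem_cons, List.not_mem_nil, or_false, not_or] at hnd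
    obtain ⟨⟨hab, hac⟩, hbc, -⟩ := hnd
    refine ⟨3, fun p => if p = a then 0 else if p = b then 1 else 2,
      fun p _ => by dsimp only; split_ifs <;> decide, ?_⟩
    refine cover6_of_injOn fun p hp q hq h => ?_
    simp only [Finset.mem_coe, hmem, List.mem_cons, List.not_mem_nil, or_false] at hp hq
    rcases hp with rfl | rfl | rfl <;> rcases hq with rfl | rfl | rfl <;> simp_all [eq_comm]
  · simp only [List.nodup_cons, List.mem_cons, List.not_mem_nil, or_false, not_or] at hnd
    obtain ⟨⟨hab, hac, had⟩, ⟨hbc, hbd⟩, hcd, -⟩ := hnd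
    have hmem' : ∀ p, p ∈ A ↔ p = a ∨ p = b ∨ p = c ∨ p = d := fun p => by
      rw [hmem]; simp only [List.mem_cons, List.not_mem_nil, or_false]
    -- the pigeonhole pair among the four values at coordinate 0
    rcases adj6_of_four (a 0) (b 0) (c 0) (d 0) with h | h | h | h | h | h
    · exact cover6_four hmem' hac had hbc hbd hcd h
    · exact cover6_four (p := a) (q := c) (r := b) (t := d) (fun x => by rw [hmem']; tauto) hab had (Ne.symm hbc) hcd hbd h
    · exact cover6_four (p := a) (q := d) (r := b) (t := c) (fun x => by rw [hmem']; tauto) hab hac (Ne.symm hbd) (Ne.symm hcd) hbc h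
    · exact cover6_four (p := b) (q := c) (r := a) (t := d) (fun x => by rw [hmem']; tauto) (Ne.symm hab) hbd (Ne.symm hac) hcd had h
    · exact cover6_four (p := b) (q := d) (r := a) (t := c) (fun x => by rw [hmem']; tauto) (Ne.symm hab) hbc (Ne.symm had) (Ne.symm hcd) hac h
    · exact cover6_four (p := c) (q := d) (r := a) (t := b) (fun x => by rw [hmem']; tauto) (Ne.symm hac) (Ne.symm hbc) (Ne.symm had) (Ne.symm hbd) hab h
  · simp only [List.length_cons] at hlen
    omega

/-- pairwise adjacent-or-equal values of `ℤ/6` lie in a pair `{s, s+1}`. -/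
theorem exists_pair_cover6 (V : Finset (ZMod 6)) (h : ∀ x ∈ V, ∀ y ∈ V, Adj6 x y) :
    ∃ s : ZMod 6, ∀ x ∈ V, x = s ∨ x = s + 1 := by
  revert h; revert V; unfold Adj6; decide

/-- Box form: a free coordinate `f₀` and hosting pairs `{s f, s f + 1}` on the other coordinates. -/
def CoveringLemmaBox6 : Prop :=
  ∀ A : Finset PT6, A.card ≤ 4 →
    ∃ f₀ : Fin 4, ∃ s : Fin 4 → ZMod 6, ∀ a ∈ A, ∃ f, f ≠ f₀ ∧ (a f = s f ∨ a f = s f + 1)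

theorem coveringLemmaBox6_holds : CoveringLemmaBox6 := by
  intro A hA
  obtain ⟨f₀, g, hgf, hg⟩ := coveringLemma6_holds A hA
  have hwin : ∀ f, ∃ s : ZMod 6, ∀ a ∈ A, g a = f → a f = s ∨ a f = s + 1 := by
    intro f
    obtain ⟨s, hs⟩ := exists_pair_cover6 ((A.filter (fun a => g a = f)).image (fun a => a f)) (by
      intro x hx y hy
      simp only [Finset.mem_image, Finset.mem_filter] at hx hy
      obtain ⟨a, ⟨ha, hga⟩, rfl⟩ := hx
      obtain ⟨b, ⟨hb, hgb⟩, rfl⟩ := hy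
      have h := hg a ha b hb (hga.trans hgb.symm)
      rw [hga] at h
      exact h)
    exact ⟨s, fun a ha hga => hs (a f) (Finset.mem_image.2 ⟨a, Finset.mem_filter.2 ⟨ha, hga⟩, rfl⟩)⟩
  choose s hs using hwin
  exact ⟨f₀, s, fun a ha => ⟨g a, hgf a ha, hs (g a) a ha rfl⟩⟩

/-! ## §3 DOWN orientation (field-free bookkeeping, as v4 `down_orientation_dead`) -/

/-- a non-negative weight with zero total is zero. -/
theorem down_orientation_dead6 {ι : Type*} (s : Finset ι) (W : ι → ℝ) (hW : ∀ y ∈ s, 0 ≤ W y)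
    (h0 : ∑ y ∈ s, W y = 0) : ∀ y ∈ s, W y = 0 :=
  (Finset.sum_eq_zero_iff_of_nonneg hW).1 h0

/-! ## §4 Basic character facts (`ζ₆` by coordinates) -/

theorem sqrt3_mul_self : Real.sqrt 3 * Real.sqrt 3 = 3 := Real.mul_self_sqrt (by norm_num)

theorem zeta6_sq : zeta6 ^ 2 = zeta6 - 1 := by
  apply Complex.ext <;> simp [zeta6, sq, Complex.mul_re, Complex.mul_im] <;> nlinarith [sqrt3_mul_self]

theorem zeta6_pow_three : zeta6 ^ 3 = -1 := by
  rw [pow_succ, zeta6_sq, sub_mul, one_mul, ← sq, zeta6_sq]; ring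

theorem zeta6_pow_six : zeta6 ^ 6 = 1 := by
  rw [show (6 : ℕ) = 3 + 3 from rfl, pow_add, zeta6_pow_three]; norm_num

theorem u6_zero : u6 0 = 1 := by simp [u6]

theorem u6_add (x y : ZMod 6) : u6 (x + y) = u6 x * u6 y := by
  unfold u6
  rw [← pow_add, ZMod.val_add]
  conv_rhs => rw [← Nat.div_add_mod (x.val + y.val) 6, pow_add, pow_mul, zeta6_pow_six, one_pow, one_mul]

theorem norm_zeta6 : ‖zeta6‖ = 1 := by
  rw [Complex.norm_eq_sqrt_sq_add_sq]
  rw [show zeta6.re ^ 2 + zeta6.im ^ 2 = 1 by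
    simp only [zeta6]; nlinarith [sqrt3_mul_self]]
  exact Real.sqrt_one

theorem norm_u6 (x : ZMod 6) : ‖u6 x‖ = 1 := by
  rw [u6, norm_pow, norm_zeta6, one_pow]

theorem u6_ne_zero (x : ZMod 6) : u6 x ≠ 0 := fun h => by
  have := norm_u6 x; rw [h, norm_zero] at this; exact zero_ne_one this


theorem u6_neg (x : ZMod 6) : u6 (-x) = (starRingEnd ℂ) (u6 x) := by
  have h1 : u6 (-x) * u6 x = 1 := by rw [← u6_add, neg_add_cancel, u6_zero]
  have h2 : (starRingEnd ℂ) (u6 x) * u6 x = 1 := by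
    rw [mul_comm, Complex.mul_conj, Complex.normSq_eq_norm_sq, norm_u6]; norm_num
  exact mul_right_cancel₀ (u6_ne_zero x) (h1.trans h2.symm)

theorem u6_sum (s : Fin 4 → ZMod 6) : u6 (∑ f, s f) = ∏ f, u6 (s f) := by
  rw [Fin.sum_univ_four, Fin.prod_univ_four, u6_add, u6_add, u6_add]

theorem zmod6_cases (x : ZMod 6) : x = 0 ∨ x = 1 ∨ x = 2 ∨ x = 3 ∨ x = 4 ∨ x = 5 := by revert x; decide

theorem five_eq_neg_one6 : (5 : ZMod 6) = -1 := by decide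

theorem sum_univ_zmod6 {M : Type*} [AddCommMonoid M] (g : ZMod 6 → M) :
    ∑ j, g j = g 0 + g 1 + g 2 + g 3 + g 4 + g 5 := by
  have h : (Finset.univ : Finset (ZMod 6)) = {0, 1, 2, 3, 4, 5} := by decide
  rw [h, Finset.sum_insert (by decide), Finset.sum_insert (by decide), Finset.sum_insert (by decide),
    Finset.sum_insert (by decide), Finset.sum_insert (by decide), Finset.sum_singleton]
  simp only [add_assoc]

theorem u6_one : u6 1 = zeta6 := by
  rw [u6, show (1 : ZMod 6).val = 1 from by decide, pow_one]

theorem u6_two : u6 2 = zeta6 - 1 := by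
  rw [u6, show (2 : ZMod 6).val = 2 from by decide, zeta6_sq]

theorem u6_three : u6 3 = -1 := by
  rw [u6, show (3 : ZMod 6).val = 3 from by decide, zeta6_pow_three]

theorem u6_four : u6 4 = -zeta6 := by
  rw [u6, show (4 : ZMod 6).val = 4 from by decide, pow_succ, zeta6_pow_three]; ring

theorem u6_five : u6 5 = 1 - zeta6 := by
  rw [five_eq_neg_one6, u6_neg, u6_one]
  apply Complex.ext <;> simp [zeta6]; norm_num

theorem u6_five_mul (x : ZMod 6) : u6 (5 * x) = (starRingEnd ℂ) (u6 x) := by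
  rw [five_eq_neg_one6, neg_one_mul, u6_neg]

/-- `chi6 k τ = ∏ f, u6 (k f * τ f)`. -/
theorem chi6_eq_prod (k τ : PT6) : chi6 k τ = ∏ f, u6 (k f * τ f) := by
  rw [chi6, ← u6_sum]

/-- `χ_{−k} = conj χ_k`. -/
theorem chi6_neg_eq_conj (k τ : PT6) : chi6 (-k) τ = (starRingEnd ℂ) (chi6 k τ) := by
  unfold chi6
  rw [← u6_neg]
  congr 1
  simp only [Pi.neg_apply, neg_mul, Finset.sum_neg_distrib]

/-- real measures have conjugate-symmetric moments. -/
theorem moment6_neg_eq_conj (ω : PT6 → ℝ) (k : PT6) :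
    moment6 ω (-k) = (starRingEnd ℂ) (moment6 ω k) := by
  unfold moment6
  rw [map_sum]
  refine Finset.sum_congr rfl fun τ _ => ?_
  rw [map_mul, Complex.conj_ofReal, chi6_neg_eq_conj]

/-- `moment6 ω (5,5,5,5) = conj μ`. -/
theorem moment6_five_eq_conj_moment6_one (ω : PT6 → ℝ) :
    moment6 ω (fun _ => 5) = (starRingEnd ℂ) (moment6 ω (fun _ => 1)) := by
  rw [show (fun _ => (5 : ZMod 6) : PT6) = -(fun _ => 1) from funext fun _ => by rw [Pi.neg_apply]; decide]
  exact moment6_neg_eq_conj ω _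

/-- **Pairing expansion**: `Σ_τ ω(τ) Π_f (Σ_j b_f(j) ζ^{j τ_f}) = Σ_k (Π_f b_f(k_f)) · moment6 ω k`. -/
theorem pairing_expansion6 (ω : PT6 → ℝ) (b : Fin 4 → ZMod 6 → ℂ) :
    ∑ τ : PT6, (ω τ : ℂ) * ∏ f, (∑ j : ZMod 6, b f j * u6 (j * τ f)) =
      ∑ k : PT6, (∏ f, b f (k f)) * moment6 ω k := by
  have hexp : ∀ τ : PT6, ∏ f, (∑ j : ZMod 6, b f j * u6 (j * τ f)) = ∑ k : PT6, (∏ f, b f (k f)) * chi6 k τ := by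
    intro τ
    rw [Finset.prod_univ_sum]
    simp only [Fintype.piFinset_univ]
    refine Finset.sum_congr rfl fun k _ => ?_
    rw [Finset.prod_mul_distrib, chi6_eq_prod]
  simp only [hexp, moment6, Finset.mul_sum]
  rw [Finset.sum_comm]
  refine Finset.sum_congr rfl fun k _ => Finset.sum_congr rfl fun τ _ => ?_
  ring

/-! ## §5 Bumps: the three-term Re-form, the μ₆ hosting coefficient `κ₆`, value tables -/

/-- The real phase bump `1 + 2 Re(a·ζ^t)`. -/
noncomputable def bump6 (a : ℂ) (t : ZMod 6) : ℝ := 1 + 2 * (a * u6 t).re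

/-- three-term coefficient table of `bump6 a`: `1` at `0`, `a` at `1`, `ā` at `5 = −1`, `0` at `2, 3, 4`. -/
noncomputable def coef3 (a : ℂ) (j : ZMod 6) : ℂ :=
  if j = 0 then 1 else if j = 1 then a else if j = 5 then (starRingEnd ℂ) a else 0

theorem coef3_zero (a : ℂ) : coef3 a 0 = 1 := by simp [coef3]

theorem coef3_one (a : ℂ) : coef3 a 1 = a := by simp [coef3, show (1 : ZMod 6) ≠ 0 from by decide]

theorem coef3_five (a : ℂ) : coef3 a 5 = (starRingEnd ℂ) a := by
  simp [coef3, show (5 : ZMod 6) ≠ 0 from by decide, show (5 : ZMod 6) ≠ 1 from by decide]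

theorem coef3_five_eq_conj (a : ℂ) : coef3 a 5 = (starRingEnd ℂ) (coef3 a 1) := by
  rw [coef3_five, coef3_one]

/-- the «free Fourier modes» `2, 3, 4` of `μ₆` carry no coefficient (in `μ₄` only the mode `2` is free). -/
theorem coef3_mid (a : ℂ) {j : ZMod 6} (h : ¬ (j = 0 ∨ j = 1 ∨ j = 5)) : coef3 a j = 0 := by
  simp only [not_or] at h
  simp [coef3, h.1, h.2.1, h.2.2]

/-- `Σ_j coef3 a j · ζ^{j t} = 1 + a ζ^t + ā ζ^{−t} = bump6 a t`. -/
theorem trig3_eq_bump6 (a : ℂ) (t : ZMod 6) : ∑ j : ZMod 6, coef3 a j * u6 (j * t) = (bump6 a t : ℂ) := by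
  rw [sum_univ_zmod6, coef3_zero, coef3_one, coef3_five,
    coef3_mid a (j := 2) (by decide), coef3_mid a (j := 3) (by decide), coef3_mid a (j := 4) (by decide),
    zero_mul, zero_mul, zero_mul, zero_mul, add_zero, add_zero, add_zero, u6_zero, one_mul, one_mul, u6_five_mul,
    ← map_mul, bump6]
  rw [add_assoc, Complex.add_conj]
  push_cast
  ring

/-- The μ₆ hosting coefficient `κ₆ = −(1 − i/√3)/2 = (−1/2, √3/6)`: `1 + 2 Re(κ₆ ζ^d)` has value table `(0,0,1,2,2,1)`. -/
noncomputable def κ6 : ℂ := ⟨-1 / 2, Real.sqrt 3 / 6⟩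

theorem κ6_ne_zero : κ6 ≠ 0 := by
  intro h
  have := congrArg Complex.re h
  norm_num [κ6] at this

theorem re_κ6_one : (κ6 * 1).re = -(1 / 2 : ℝ) := by norm_num [κ6]

theorem re_κ6_zeta : (κ6 * zeta6).re = -(1 / 2 : ℝ) := by
  have h := sqrt3_mul_self
  simp only [Complex.mul_re, κ6, zeta6]
  nlinarith [h]

theorem re_κ6_zeta_sub_one : (κ6 * (zeta6 - 1)).re = 0 := by
  rw [mul_sub, Complex.sub_re, re_κ6_zeta, mul_one]; norm_num [κ6]

theorem re_κ6_neg_one : (κ6 * -1).re = (1 / 2 : ℝ) := by norm_num [κ6]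

theorem re_κ6_neg_zeta : (κ6 * -zeta6).re = (1 / 2 : ℝ) := by
  rw [mul_neg, Complex.neg_re, re_κ6_zeta]; norm_num

theorem re_κ6_one_sub_zeta : (κ6 * (1 - zeta6)).re = 0 := by
  rw [mul_sub, Complex.sub_re, re_κ6_zeta, mul_one]; norm_num [κ6]

/-- adjacent-pair bump by VALUE TABLE: `0` on `{s, s+1}`, `1` on `{s+2, s+5}`, `2` on `{s+3, s+4}` (rational, as in μ₄). -/
noncomputable def bumpPair6 (s t : ZMod 6) : ℝ :=
  if t = s ∨ t = s + 1 then 0 else if t = s + 2 ∨ t = s + 5 then 1 else 2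

theorem bumpPair6_nonneg (s t : ZMod 6) : 0 ≤ bumpPair6 s t := by
  unfold bumpPair6; split_ifs <;> norm_num

theorem bumpPair6_eq_zero {s t : ZMod 6} (h : t = s ∨ t = s + 1) : bumpPair6 s t = 0 := by
  unfold bumpPair6; rw [if_pos h]

theorem host_arg6 (s t : ZMod 6) : κ6 * (starRingEnd ℂ) (u6 s) * u6 t = κ6 * u6 (t - s) := by
  rw [sub_eq_add_neg, u6_add, u6_neg]; ring

theorem f6_two_a (s : ZMod 6) : ¬((2 : ZMod 6) + s = s ∨ (2 : ZMod 6) + s = s + 1) := by revert s; decide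
theorem f6_two_b (s : ZMod 6) : ((2 : ZMod 6) + s = s + 2 ∨ (2 : ZMod 6) + s = s + 5) := by revert s; decide
theorem f6_three_a (s : ZMod 6) : ¬((3 : ZMod 6) + s = s ∨ (3 : ZMod 6) + s = s + 1) := by revert s; decide
theorem f6_three_b (s : ZMod 6) : ¬((3 : ZMod 6) + s = s + 2 ∨ (3 : ZMod 6) + s = s + 5) := by revert s; decide
theorem f6_four_a (s : ZMod 6) : ¬((4 : ZMod 6) + s = s ∨ (4 : ZMod 6) + s = s + 1) := by revert s; decide
theorem f6_four_b (s : ZMod 6) : ¬((4 : ZMod 6) + s = s + 2 ∨ (4 : ZMod 6) + s = s + 5) := by revert s; decide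
theorem f6_five_a (s : ZMod 6) : ¬((5 : ZMod 6) + s = s ∨ (5 : ZMod 6) + s = s + 1) := by revert s; decide
theorem f6_five_b (s : ZMod 6) : ((5 : ZMod 6) + s = s + 2 ∨ (5 : ZMod 6) + s = s + 5) := by revert s; decide

/-- The hosting bump in Re-form IS the value table `bumpPair6` (six cases on `t − s`). -/
theorem bump_host_eq_bumpPair6 (s t : ZMod 6) : bump6 (κ6 * (starRingEnd ℂ) (u6 s)) t = bumpPair6 s t := by
  unfold bump6 bumpPair6
  rw [host_arg6]
  obtain ⟨d, rfl⟩ : ∃ d, t = d + s := ⟨t - s, (sub_add_cancel t s).symm⟩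
  rw [add_sub_cancel_right]
  rcases zmod6_cases d with rfl | rfl | rfl | rfl | rfl | rfl
  · rw [zero_add, u6_zero, re_κ6_one, if_pos (Or.inl rfl)]; norm_num
  · rw [u6_one, re_κ6_zeta, if_pos (Or.inr (add_comm _ _))]; norm_num
  · rw [u6_two, re_κ6_zeta_sub_one, if_neg (f6_two_a s), if_pos (f6_two_b s)]; norm_num
  · rw [u6_three, re_κ6_neg_one, if_neg (f6_three_a s), if_neg (f6_three_b s)]; norm_num
  · rw [u6_four, re_κ6_neg_zeta, if_neg (f6_four_a s), if_neg (f6_four_b s)]; norm_num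
  · rw [u6_five, re_κ6_one_sub_zeta, if_neg (f6_five_a s), if_pos (f6_five_b s)]; norm_num

/-- the free bump `1 + ½ Re(ζ^{t − w})` is strictly positive (`|Re| ≤ 1`). -/
theorem bump6_free_pos (w t : ZMod 6) : 0 < bump6 (u6 (-w) / 4) t := by
  unfold bump6
  have h1 : |(u6 (-w) / 4 * u6 t).re| ≤ 1 / 4 := by
    refine (Complex.abs_re_le_norm _).trans ?_
    rw [norm_mul, norm_div, norm_u6, norm_u6]; norm_num
  have h2 := neg_le_of_abs_le h1
  linarith

/-! ## §6 Assembly: the test function `F_w = Π_f φ_f`, the reduced pairing, the six-phase rotation -/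

/-- amplitude table of `F_w`: the free bump `ζ^{−w}/4` on `f₀`, hosting coefficients `κ₆ conj(ζ^{s f})` elsewhere. -/
noncomputable def amp (f₀ : Fin 4) (w : ZMod 6) (s : Fin 4 → ZMod 6) (f : Fin 4) : ℂ :=
  if f = f₀ then u6 (-w) / 4 else κ6 * (starRingEnd ℂ) (u6 (s f))

/-- Coefficient tables of `F_w`. -/
noncomputable def cvec6 (f₀ : Fin 4) (w : ZMod 6) (s : Fin 4 → ZMod 6) (f : Fin 4) : ZMod 6 → ℂ :=
  coef3 (amp f₀ w s f)

/-- Value of the factor `φ_f` of `F_w` at `t`. -/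
noncomputable def vvec6 (f₀ : Fin 4) (w : ZMod 6) (s : Fin 4 → ZMod 6) (f : Fin 4) (t : ZMod 6) : ℝ :=
  bump6 (amp f₀ w s f) t

theorem vvec6_nonneg (f₀ : Fin 4) (w : ZMod 6) (s : Fin 4 → ZMod 6) (f : Fin 4) (t : ZMod 6) :
    0 ≤ vvec6 f₀ w s f t := by
  unfold vvec6 amp; split_ifs
  · exact (bump6_free_pos w t).le
  · rw [bump_host_eq_bumpPair6]; exact bumpPair6_nonneg _ t

theorem vvec6_eq_zero {f₀ : Fin 4} {w : ZMod 6} {s : Fin 4 → ZMod 6} {f : Fin 4} {t : ZMod 6} (hf : f ≠ f₀)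
    (h : t = s f ∨ t = s f + 1) : vvec6 f₀ w s f t = 0 := by
  unfold vvec6 amp
  rw [if_neg hf, bump_host_eq_bumpPair6]
  exact bumpPair6_eq_zero h

/-- each factor's trigonometric polynomial is the real value `vvec6`. -/
theorem trig_cvec6 (f₀ : Fin 4) (w : ZMod 6) (s : Fin 4 → ZMod 6) (f : Fin 4) (t : ZMod 6) :
    ∑ j : ZMod 6, cvec6 f₀ w s f j * u6 (j * t) = (vvec6 f₀ w s f t : ℂ) :=
  trig3_eq_bump6 _ t

theorem cvec6_mid (f₀ : Fin 4) (w : ZMod 6) (s : Fin 4 → ZMod 6) (f : Fin 4) {j : ZMod 6}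
    (h : ¬ (j = 0 ∨ j = 1 ∨ j = 5)) : cvec6 f₀ w s f j = 0 := coef3_mid _ h

theorem cvec6_five (f₀ : Fin 4) (w : ZMod 6) (s : Fin 4 → ZMod 6) (f : Fin 4) :
    cvec6 f₀ w s f 5 = (starRingEnd ℂ) (cvec6 f₀ w s f 1) := coef3_five_eq_conj _

/-- the frequency-`(1,1,1,1)` coefficient of `F_w`: `ζ^{−w}/4 · P`, `P = ∏_{f ≠ f₀} κ₆ conj(ζ^{s f})`. -/
theorem prod_cvec6_one (f₀ : Fin 4) (w : ZMod 6) (s : Fin 4 → ZMod 6) :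
    ∏ f, cvec6 f₀ w s f 1 = u6 (-w) / 4 * ∏ f ∈ Finset.univ.erase f₀, κ6 * (starRingEnd ℂ) (u6 (s f)) := by
  rw [← Finset.mul_prod_erase _ _ (Finset.mem_univ f₀)]
  congr 1
  · simp [cvec6, amp, coef3_one]
  · exact Finset.prod_congr rfl fun f hf => by simp [cvec6, amp, Finset.ne_of_mem_erase hf, coef3_one]

/-- Four of the six rotated half-planes already meet in `0` (`1, −1, ζ, −ζ`; uses `√3 ≠ 0`). -/
theorem eq_zero_of_re_rot6_nonpos (z : ℂ) (h0 : (1 * z).re ≤ 0) (h3 : (-1 * z).re ≤ 0)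
    (h1 : (zeta6 * z).re ≤ 0) (h4 : (-zeta6 * z).re ≤ 0) : z = 0 := by
  have hre : z.re = 0 := by simp at h0 h3; linarith
  have hz : (zeta6 * z).re = 0 := by rw [neg_mul, Complex.neg_re] at h4; linarith
  rw [Complex.mul_re, hre, mul_zero, zero_sub, neg_eq_zero] at hz
  simp only [zeta6] at hz
  have hs : (0 : ℝ) < Real.sqrt 3 := Real.sqrt_pos.2 (by norm_num)
  have him : z.im = 0 := by
    rcases mul_eq_zero.1 hz with h | h
    · exact absurd h (by positivity)
    · exact h
  exact Complex.ext hre him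

/-- **One rotation `w`**: `Re((∏_f c_f(1)) · μ) ≤ 0`. -/
theorem rot_step6 (ω : PT6 → ℝ) (A : Finset PT6) (hω : ∀ τ, τ ∉ A → ω τ ≤ 0)
    (hK : ∀ k, KAdm6 k → moment6 ω k = 0) (f₀ : Fin 4) (s : Fin 4 → ZMod 6)
    (hbox : ∀ a ∈ A, ∃ f, f ≠ f₀ ∧ (a f = s f ∨ a f = s f + 1)) (w : ZMod 6) :
    ((∏ f, cvec6 f₀ w s f 1) * moment6 ω (fun _ => 1)).re ≤ 0 := by
  have hS := pairing_expansion6 ω (cvec6 f₀ w s)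
  have hred : ∑ k : PT6, (∏ f, cvec6 f₀ w s f (k f)) * moment6 ω k =
      (∏ f, cvec6 f₀ w s f 1) * moment6 ω (fun _ => 1) + (∏ f, cvec6 f₀ w s f 5) * moment6 ω (fun _ => 5) := by
    have hne : (fun _ => (1 : ZMod 6) : PT6) ≠ (fun _ => 5) := fun h => absurd (congr_fun h 0) (by decide)
    rw [Finset.sum_eq_add (fun _ => (1 : ZMod 6)) (fun _ => (5 : ZMod 6)) hne]
    · intro k _ hk
      by_cases h : ∃ f, ¬ (k f = 0 ∨ k f = 1 ∨ k f = 5)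
      · obtain ⟨f, hf⟩ := h
        rw [Finset.prod_eq_zero (Finset.mem_univ f) (cvec6_mid f₀ w s f hf), zero_mul]
      · simp only [not_exists, not_not] at h
        rw [hK k ⟨h, hk.1, hk.2⟩, mul_zero]
    · intro h; exact absurd (Finset.mem_univ _) h
    · intro h; exact absurd (Finset.mem_univ _) h
  have hc5 : ∏ f, cvec6 f₀ w s f 5 = (starRingEnd ℂ) (∏ f, cvec6 f₀ w s f 1) := by
    rw [map_prod]; exact Finset.prod_congr rfl fun f _ => cvec6_five f₀ w s f
  rw [hred, hc5, moment6_five_eq_conj_moment6_one, ← map_mul, Complex.add_conj] at hS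
  have hreal : ∑ τ : PT6, (ω τ : ℂ) * ∏ f, (∑ j : ZMod 6, cvec6 f₀ w s f j * u6 (j * τ f)) =
      ((∑ τ : PT6, ω τ * ∏ f, vvec6 f₀ w s f (τ f) : ℝ) : ℂ) := by
    push_cast
    refine Finset.sum_congr rfl fun τ _ => ?_
    congr 1
    exact Finset.prod_congr rfl fun f _ => trig_cvec6 f₀ w s f (τ f)
  have hnonpos : ∑ τ : PT6, ω τ * ∏ f, vvec6 f₀ w s f (τ f) ≤ 0 := by
    apply Finset.sum_nonpos
    intro τ _
    by_cases hτ : τ ∈ A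
    · obtain ⟨f, hf, hval⟩ := hbox τ hτ
      have h0 : ∏ f, vvec6 f₀ w s f (τ f) = 0 :=
        Finset.prod_eq_zero (Finset.mem_univ f) (vvec6_eq_zero hf hval)
      rw [h0, mul_zero]
    · exact mul_nonpos_iff.2 (Or.inr ⟨hω τ hτ, Finset.prod_nonneg fun f _ => vvec6_nonneg f₀ w s f (τ f)⟩)
  rw [hreal] at hS
  have h2 : (∑ τ : PT6, ω τ * ∏ f, vvec6 f₀ w s f (τ f)) =
      2 * ((∏ f, cvec6 f₀ w s f 1) * moment6 ω (fun _ => 1)).re := by exact_mod_cast hS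
  linarith

/-- **The μ₆ phase-torus law holds at the seed rank** (corank `≤ 4`): kernel version of memo §3 — the transplant of v4
`phaseTorusLaw_holds` with `adj6_of_four`, the `{s, s+1}` pair bump `(0,0,1,2,2,1)` and four of the six rotations. -/
theorem phaseTorusLaw6_holds : PhaseTorusLaw6 := by
  intro ω A hA hω hK
  obtain ⟨f₀, s, hbox⟩ := coveringLemmaBox6_holds A hA
  set P : ℂ := ∏ f ∈ Finset.univ.erase f₀, κ6 * (starRingEnd ℂ) (u6 (s f)) with hP
  have hPne : P ≠ 0 := Finset.prod_ne_zero_iff.2 fun f _ =>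
    mul_ne_zero κ6_ne_zero ((map_ne_zero _).2 (u6_ne_zero _))
  have key : ∀ w : ZMod 6, (u6 (-w) * (P * moment6 ω (fun _ => 1) / 4)).re ≤ 0 := by
    intro w
    have h := rot_step6 ω A hω hK f₀ s hbox w
    rw [prod_cvec6_one] at h
    have hrw : u6 (-w) / 4 * P * moment6 ω (fun _ => 1) = u6 (-w) * (P * moment6 ω (fun _ => 1) / 4) := by ring
    rw [hrw] at h
    exact h
  have hz : P * moment6 ω (fun _ => 1) / 4 = 0 := by
    apply eq_zero_of_re_rot6_nonpos
    · have := key 0; rwa [neg_zero, u6_zero] at this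
    · have := key 3; rwa [show (-3 : ZMod 6) = 3 from by decide, u6_three] at this
    · have := key 5; rwa [show (-5 : ZMod 6) = 1 from by decide, u6_one] at this
    · have := key 2; rwa [show (-2 : ZMod 6) = 4 from by decide, u6_four] at this
  have h4 : (4 : ℂ) ≠ 0 := by norm_num
  rcases mul_eq_zero.1 ((div_eq_zero_iff.1 hz).resolve_right h4) with h | h
  · exact absurd h hPne
  · exact h

theorem phaseTorusLaw6N_four : PhaseTorusLaw6N 4 := phaseTorusLaw6_holds

/-- the DOWN-orientation reading on the torus: `ω ≥ 0` with zero total mass is zero (any corank). -/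
theorem phaseTorusLaw6_down (ω : PT6 → ℝ) (hω : ∀ τ, 0 ≤ ω τ) (h0 : ∑ τ, ω τ = 0) : ω = 0 :=
  funext fun τ => down_orientation_dead6 Finset.univ ω (fun y _ => hω y) h0 τ (Finset.mem_univ τ)

end Summit.HodgeConjecture.HodgeConjecture.Cruxes.BlochSeedDiscOne.PhaseTorusMu6
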